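import Mathlib
import Summits.KontsevichZagierPeriods.Zeta5Search.RayFaceKitCover
import Summits.KontsevichZagierPeriods.Zeta5Search.CellKitRays
import HarnessLib

/-!
# ζ(5) search — RAY FACE KIT IV: every proportional LINEAR RAY `n·(2α+12+ε; α+6,…,α)` (record ray, families `bFam t`, X-rays) (P1 g14)

HONEST FRAMING: systematic search; no irrationality claim unless certified.  Cell `pub-zeta5`, prover seat P1, generation 14.
Integer bookkeeping of net exponents; every kernel exponent the consumers feed stays `< 1` — no irrationality content; nothing
about `ζ(5)`.

P1 g7's `CellKitRays` shows that every ray of the atlases is a LINEAR RAY `bLin a e n = (2a + 12n + e; a+6n, …, a)` with the block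
form `netExp_bLin` / `blockCount_bLin` (blocks `[a + (6−j)n, a + (6+j)n + e]`).  When `a = α·n` and `e = ε·n` (the record ray
`bRec n = bLin (11n) (7n) n`, `bFam t n = bLin (tn) ((t−4)n) n`, `bX1Ray n = bLin (16n) (17n) n`, …) the blocks are `[(α+6−j)n, (α+6+j+ε)n]`
and `b₀ = (2α+12+ε)n`, i.e. exactly the block form of `RayFaceKitCover.cover_of_faceCheck` with `lo = linLos α`, `hi = linHis α ε`,
`B₀ = 2α+12+ε`.  This file records that instance (`linRay_netExp`, `linRay_cover`) and the record-ray corollary (`record_cover`,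
`B₀ = 41`, blocks `[17n,24n], …, [11n,30n]`), so that class-type covers of ANY such ray come from one `decide` of `faceCheck` —
the same 30-line window files as ray C1's `RayC1LettersK6*` (P1 g14).
-/

namespace Summit.KontsevichZagierPeriods.Zeta5Search.LinRayFaceKit

open Finset
open Summit.KontsevichZagierPeriods.Zeta5Search.RayFaceKit
open Summit.KontsevichZagierPeriods.Zeta5Search.ClassTypeCover (Cover)
open Summit.KontsevichZagierPeriods.Zeta5Search.ClusterValuation (netExp blockCount bRec)
open Summit.KontsevichZagierPeriods.Zeta5Search.CellKit (bLin netExp_bLin blockCount_bLin bRec_eq_bLin)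

/-- Lower block coefficients of the proportional linear ray: block `j` starts at `(α + 6 − j)·n`. -/
def linLos (α : ℕ) : List ℕ := [α + 6, α + 5, α + 4, α + 3, α + 2, α + 1, α]

/-- Upper block coefficients: block `j` ends at `(α + 6 + j + ε)·n`. -/
def linHis (α ε : ℕ) : List ℕ := [α + 6 + ε, α + 7 + ε, α + 8 + ε, α + 9 + ε, α + 10 + ε, α + 11 + ε, α + 12 + ε]

/-- Entries of `linLos`. -/
theorem linLos_getD {α j : ℕ} (hj : j < 7) : (linLos α).getD j 0 = α + 6 - j := by
  interval_cases j <;> simp [linLos]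

/-- Entries of `linHis`. -/
theorem linHis_getD {α ε j : ℕ} (hj : j < 7) : (linHis α ε).getD j 0 = α + 6 + j + ε := by
  interval_cases j <;> simp [linHis]

/-- **Block form of a proportional linear ray** in the kit's shape. -/
theorem linRay_netExp (α ε n q : ℕ) :
    netExp (bLin (α * n) (ε * n) n) q =
      1 - (blockSum 7 (linLos α) (linHis α ε) n q : ℤ) + if 2 * q = (2 * α + 12 + ε) * n then 1 else 0 := by
  rw [netExp_bLin, blockCount_bLin]
  have hc : (2 * q = 2 * (α * n) + 12 * n + ε * n) ↔ (2 * q = (2 * α + 12 + ε) * n) := by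
    constructor <;> intro h <;> nlinarith [h]
  have hs : (∑ j ∈ range 7, if α * n + (6 - j) * n ≤ q ∧ q ≤ α * n + (6 + j) * n + ε * n then 1 else 0) =
      blockSum 7 (linLos α) (linHis α ε) n q := by
    unfold blockSum
    refine sum_congr rfl fun j hj => ?_
    have hj7 : j < 7 := mem_range.1 hj
    rw [linLos_getD hj7, linHis_getD hj7]
    have e1 : α * n + (6 - j) * n = (α + 6 - j) * n := by
      have : α + 6 - j = α + (6 - j) := by omega
      rw [this, Nat.add_mul]
    have e2 : α * n + (6 + j) * n + ε * n = (α + 6 + j + ε) * n := by ring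
    rw [e1, e2]
  rw [hs]
  simp only [hc]

/-- `b₀ = (2α + 12 + ε)·n`. -/
theorem linRay_zero (α ε n : ℕ) : bLin (α * n) (ε * n) n 0 = (((2 * α + 12 + ε) * n : ℕ) : ℤ) := by
  rw [CellKit.bLin_zero]; push_cast; ring

/-- **Cover of a proportional linear ray from a checked face certificate.** -/
theorem linRay_cover (α ε : ℕ) (c : FaceCert) (hc : faceCheck (2 * α + 12 + ε) 7 (linLos α) (linHis α ε) c = true)
    {n p : ℕ} [Fact p.Prime] (hn : c.win.N0 ≤ n) (hr : n % 2 = c.win.r) (hp2 : p % 2 = 1)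
    (hA : c.win.a1 * n < c.win.a2 * p) (hB : c.win.b2 * p < c.win.b1 * n) :
    Cover (bLin (α * n) (ε * n) n) p (coverOf 7 c) :=
  cover_of_faceCheck (b := fun n => bLin (α * n) (ε * n) n) (B0 := 2 * α + 12 + ε) (fun n => linRay_zero α ε n)
    (fun n q => linRay_netExp α ε n q) hc ⟨hn, hA, hB, hr, hp2⟩

/-- Lower block coefficients of the record ray `n·(41; 17,…,11)`. -/
def recLos : List ℕ := [17, 16, 15, 14, 13, 12, 11]

/-- Upper block coefficients of the record ray. -/
def recHis : List ℕ := [24, 25, 26, 27, 28, 29, 30]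

/-- **Record-ray cover from a checked face certificate** (`B₀ = 41`). -/
theorem record_cover (c : FaceCert) (hc : faceCheck 41 7 recLos recHis c = true) {n p : ℕ} [Fact p.Prime]
    (hn : c.win.N0 ≤ n) (hr : n % 2 = c.win.r) (hp2 : p % 2 = 1) (hA : c.win.a1 * n < c.win.a2 * p)
    (hB : c.win.b2 * p < c.win.b1 * n) : Cover (bRec n) p (coverOf 7 c) := by
  rw [bRec_eq_bLin]
  exact linRay_cover 11 7 c hc hn hr hp2 hA hB

end Summit.KontsevichZagierPeriods.Zeta5Search.LinRayFaceKit
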